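import Mathlib
import Summits.NavierStokesRegularity.FluidComputer.TransportGalerkinInvariance
import Summits.NavierStokesRegularity.FluidComputer.TransportGalerkinContinuity
import Summits.NavierStokesRegularity.FluidComputer.LatticeBoxInterpolation
import HarnessLib

/-!
# Galerkin limit of the transport model, XV-a: the constrained Galerkin level and its field (instab g19, cell `ns-blowup`, 2026-08-27)

HONEST FRAMING (human ruling D-0035): nothing here is a claim about Navier–Stokes blow-up.
WHAT THIS IS NOT: not NS — the finite-dimensional Galerkin ODE of the MODEL (host-perturbation
equation on `𝕋³` in the scaled phase space `E = lp (ℤ³ → ℂ³) 2`): a closed invariant subspace, a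
locally Lipschitz field, an `L²` energy bound, and the tree's continuation principle. No certificate
is touched and no census word moves.

PURPOSE. After parts IV–XIV, the KEEP word for the model
(`TransportGalerkinEmergenceLevels.half_prediction_nsField_of_levels`,
`TransportGalerkinAbcH2.exists_keep_eigenvector_abc_of_levels`) takes the Galerkin levels `u n` of the
seed as INPUTS: `C¹` solutions of `y' = P_N F(y)` on `[0, T]` in `range P_N` keeping the three linear
clauses. This file and its companion CONSTRUCT them for `V = ℂ³`, `π = proj`, `P = lerayCLM` and any
rapidly decreasing, real, divergence-free host with `ν ≥ 0`:

* §1 `levelSubspace N` — the closed real subspace `{P_N x = x} ∩ {clauses}` of `E` (complete);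
* §2 `levelField N` — `P_N ∘ F` restricted to it (well defined by part XIV's invariance), locally
  Lipschitz (`TransportGalerkinContinuity.norm_nsField_sub_sq_le` on the finitely supported box
  `ρ 𝟙_{cube N}` + the finite cube's inverse inequality `‖·‖₂ ≤ ⟨corner⟩² ‖·‖₀`);
* the companion file `TransportGalerkinLevelExistence.lean` (XV-b) adds the a-priori `L²` bound and
  the global existence theorem `exists_level_solution`.

The two `def`s (`levelSubspace`, `levelField`) are REAL objects (a `Submodule ℝ E` given by four
linear closed constraints; a function on its subtype), no junk values.
-/

noncomputable section

open scoped ENNReal NNReal ComplexConjugate InnerProductSpace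
open Set Filter Topology

namespace Summit.NavierStokesRegularity.FluidComputer.TransportGalerkinLevelSubspace

open RCLike
open Literature.Analysis.FunctionSpaces Literature.Analysis.FunctionSpaces.Lattice
open Literature.Analysis.FunctionSpaces.Torus Literature.Analysis.FunctionSpaces.EuclideanSpace
open Literature.Analysis.ODE Literature.Analysis.FluidPDE
open Summit.NavierStokesRegularity.FluidComputer.GalerkinLatticePhaseSpace
open Summit.NavierStokesRegularity.FluidComputer.TransportGalerkin
open Summit.NavierStokesRegularity.FluidComputer.TransportGalerkinRapid
open Summit.NavierStokesRegularity.FluidComputer.TransportGalerkinBox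
open Summit.NavierStokesRegularity.FluidComputer.TransportGalerkinEigen
open Summit.NavierStokesRegularity.FluidComputer.TransportGalerkinContinuity
open Summit.NavierStokesRegularity.FluidComputer.TransportGalerkinInvariance
open Summit.NavierStokesRegularity.FluidComputer.TransportGalerkinAbc
open Summit.NavierStokesRegularity.FluidComputer.LatticeBoxInterpolation
open Summit.NavierStokesRegularity.FluidComputer.TransportGalerkinOneSided

/-! ## §1 The constrained level subspace -/

section Subspace

/-- **The constrained Galerkin level** `S_N = {x ∈ E : P_N x = x, Π_k x(k) = x(k), x real, x transversal}`
as a real subspace of `E = lp (ℤ³ → ℂ³) 2` (reality is conjugate-linear, so the scalars are real). -/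
def levelSubspace (N : ℕ) : Submodule ℝ (lp (fun _ : (Fin 3 → ℤ) => EuclideanSpace ℂ (Fin 3)) 2) where
  carrier := {x | cubeProj N x = x ∧ (∀ k, lerayCLM k ((x : (Fin 3 → ℤ) → EuclideanSpace ℂ (Fin 3)) k) =
      (x : (Fin 3 → ℤ) → EuclideanSpace ℂ (Fin 3)) k) ∧
    (∀ (j : Fin 3) (k : Fin 3 → ℤ), (EuclideanSpace.proj j : EuclideanSpace ℂ (Fin 3) →L[ℂ] ℂ)
        ((x : (Fin 3 → ℤ) → EuclideanSpace ℂ (Fin 3)) (-k)) =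
      conj ((EuclideanSpace.proj j : EuclideanSpace ℂ (Fin 3) →L[ℂ] ℂ) ((x : (Fin 3 → ℤ) → EuclideanSpace ℂ (Fin 3)) k))) ∧
    (∀ k : Fin 3 → ℤ, ∑ j, ((k j : ℤ) : ℂ) * (EuclideanSpace.proj j : EuclideanSpace ℂ (Fin 3) →L[ℂ] ℂ)
      ((x : (Fin 3 → ℤ) → EuclideanSpace ℂ (Fin 3)) k) = 0)}
  zero_mem' := by
    refine ⟨map_zero _, fun k => ?_, fun j k => ?_, fun k => ?_⟩
    · simp
    · simp
    · simp
  add_mem' := by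
    rintro x y ⟨hx1, hx2, hx3, hx4⟩ ⟨hy1, hy2, hy3, hy4⟩
    refine ⟨by rw [map_add, hx1, hy1], fun k => ?_, fun j k => ?_, fun k => ?_⟩
    · rw [lp.coeFn_add, Pi.add_apply, map_add, hx2, hy2]
    · rw [lp.coeFn_add, Pi.add_apply, Pi.add_apply, map_add, map_add, map_add, hx3, hy3]
    · simp only [lp.coeFn_add, Pi.add_apply, map_add, mul_add, Finset.sum_add_distrib, hx4, hy4, add_zero]
  smul_mem' := by
    rintro r x ⟨hx1, hx2, hx3, hx4⟩
    refine ⟨by rw [map_smul, hx1], fun k => ?_, fun j k => ?_, fun k => ?_⟩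
    · rw [coe_real_smul_apply, map_smul, hx2]
    · rw [coe_real_smul_apply, coe_real_smul_apply, map_smul, map_smul, hx3, smul_eq_mul, smul_eq_mul, map_mul,
        Complex.conj_ofReal]
    · simp only [coe_real_smul_apply, map_smul, smul_eq_mul, mul_left_comm _ (r : ℂ), ← Finset.mul_sum, hx4,
        mul_zero]

/-- Membership in the constrained level, unfolded. -/
theorem mem_levelSubspace {N : ℕ} {x : lp (fun _ : (Fin 3 → ℤ) => EuclideanSpace ℂ (Fin 3)) 2} :
    x ∈ levelSubspace N ↔ cubeProj N x = x ∧ (∀ k, lerayCLM k ((x : (Fin 3 → ℤ) → EuclideanSpace ℂ (Fin 3)) k) =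
      (x : (Fin 3 → ℤ) → EuclideanSpace ℂ (Fin 3)) k) ∧
    (∀ (j : Fin 3) (k : Fin 3 → ℤ), (EuclideanSpace.proj j : EuclideanSpace ℂ (Fin 3) →L[ℂ] ℂ)
        ((x : (Fin 3 → ℤ) → EuclideanSpace ℂ (Fin 3)) (-k)) =
      conj ((EuclideanSpace.proj j : EuclideanSpace ℂ (Fin 3) →L[ℂ] ℂ) ((x : (Fin 3 → ℤ) → EuclideanSpace ℂ (Fin 3)) k))) ∧
    (∀ k : Fin 3 → ℤ, ∑ j, ((k j : ℤ) : ℂ) * (EuclideanSpace.proj j : EuclideanSpace ℂ (Fin 3) →L[ℂ] ℂ)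
      ((x : (Fin 3 → ℤ) → EuclideanSpace ℂ (Fin 3)) k) = 0) :=
  Iff.rfl

/-- A constrained level element lies in the box of radii `‖x‖ 𝟙_{cube N}`-style bounds: it lies in
`box ρ proj lerayCLM` for any radii dominating its coordinates. -/
theorem mem_box_of_mem_levelSubspace {N : ℕ} {x : lp (fun _ : (Fin 3 → ℤ) => EuclideanSpace ℂ (Fin 3)) 2}
    (hx : x ∈ levelSubspace N) {ρ : (Fin 3 → ℤ) → ℝ}
    (hρ : ∀ k, ‖(x : (Fin 3 → ℤ) → EuclideanSpace ℂ (Fin 3)) k‖ ≤ ρ k) :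
    x ∈ box ρ (fun j => (EuclideanSpace.proj j : EuclideanSpace ℂ (Fin 3) →L[ℂ] ℂ)) lerayCLM :=
  mem_box.2 ⟨hρ, hx.2.1, hx.2.2.1, hx.2.2.2⟩

/-- **The constrained level is closed** (an intersection of kernels of continuous maps), hence
complete. -/
theorem isClosed_levelSubspace (N : ℕ) :
    IsClosed (levelSubspace N : Set (lp (fun _ : (Fin 3 → ℤ) => EuclideanSpace ℂ (Fin 3)) 2)) := by
  have hev := continuous_apply_coe (d := Fin 3) (V := EuclideanSpace ℂ (Fin 3))
  have h0 : IsClosed {x : lp (fun _ : (Fin 3 → ℤ) => EuclideanSpace ℂ (Fin 3)) 2 | cubeProj N x = x} :=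
    isClosed_eq (cubeProj N).continuous continuous_id
  have h2 : IsClosed {x : lp (fun _ : (Fin 3 → ℤ) => EuclideanSpace ℂ (Fin 3)) 2 |
      ∀ k, lerayCLM k ((x : (Fin 3 → ℤ) → EuclideanSpace ℂ (Fin 3)) k) = x k} := by
    rw [Set.setOf_forall]
    exact isClosed_iInter fun k => isClosed_eq ((lerayCLM k).continuous.comp (hev k)) (hev k)
  have h3 : IsClosed {x : lp (fun _ : (Fin 3 → ℤ) => EuclideanSpace ℂ (Fin 3)) 2 |
      ∀ (j : Fin 3) (k : Fin 3 → ℤ), (EuclideanSpace.proj j : EuclideanSpace ℂ (Fin 3) →L[ℂ] ℂ)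
        ((x : (Fin 3 → ℤ) → EuclideanSpace ℂ (Fin 3)) (-k)) =
        conj ((EuclideanSpace.proj j : EuclideanSpace ℂ (Fin 3) →L[ℂ] ℂ) (x k))} := by
    rw [Set.setOf_forall]
    refine isClosed_iInter fun j => ?_
    rw [Set.setOf_forall]
    exact isClosed_iInter fun k => isClosed_eq
      ((EuclideanSpace.proj j : EuclideanSpace ℂ (Fin 3) →L[ℂ] ℂ).continuous.comp (hev (-k)))
      (Complex.continuous_conj.comp ((EuclideanSpace.proj j : EuclideanSpace ℂ (Fin 3) →L[ℂ] ℂ).continuous.comp (hev k)))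
  have h4 : IsClosed {x : lp (fun _ : (Fin 3 → ℤ) => EuclideanSpace ℂ (Fin 3)) 2 |
      ∀ k : Fin 3 → ℤ, ∑ j, ((k j : ℤ) : ℂ) * (EuclideanSpace.proj j : EuclideanSpace ℂ (Fin 3) →L[ℂ] ℂ)
        ((x : (Fin 3 → ℤ) → EuclideanSpace ℂ (Fin 3)) k) = 0} := by
    rw [Set.setOf_forall]
    refine isClosed_iInter fun k => isClosed_eq ?_ continuous_const
    exact continuous_finsetSum _ fun j _ => continuous_const.mul
      ((EuclideanSpace.proj j : EuclideanSpace ℂ (Fin 3) →L[ℂ] ℂ).continuous.comp (hev k))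
  have heq : (levelSubspace N : Set (lp (fun _ : (Fin 3 → ℤ) => EuclideanSpace ℂ (Fin 3)) 2)) =
      {x | cubeProj N x = x} ∩ ({x : lp (fun _ : (Fin 3 → ℤ) => EuclideanSpace ℂ (Fin 3)) 2 |
        ∀ k, lerayCLM k ((x : (Fin 3 → ℤ) → EuclideanSpace ℂ (Fin 3)) k) = x k} ∩
      ({x : lp (fun _ : (Fin 3 → ℤ) => EuclideanSpace ℂ (Fin 3)) 2 |
        ∀ (j : Fin 3) (k : Fin 3 → ℤ), (EuclideanSpace.proj j : EuclideanSpace ℂ (Fin 3) →L[ℂ] ℂ)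
          ((x : (Fin 3 → ℤ) → EuclideanSpace ℂ (Fin 3)) (-k)) =
          conj ((EuclideanSpace.proj j : EuclideanSpace ℂ (Fin 3) →L[ℂ] ℂ) (x k))} ∩
       {x : lp (fun _ : (Fin 3 → ℤ) => EuclideanSpace ℂ (Fin 3)) 2 |
          ∀ k : Fin 3 → ℤ, ∑ j, ((k j : ℤ) : ℂ) * (EuclideanSpace.proj j : EuclideanSpace ℂ (Fin 3) →L[ℂ] ℂ)
            ((x : (Fin 3 → ℤ) → EuclideanSpace ℂ (Fin 3)) k) = 0})) := by
    ext x
    simp only [SetLike.mem_coe, mem_levelSubspace, Set.mem_setOf_eq, Set.mem_inter_iff]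
  rw [heq]
  exact h0.inter (h2.inter (h3.inter h4))

/-- Elements of the constrained level are finitely supported, hence rapidly decreasing. -/
theorem rapidDecay_of_mem_levelSubspace {N : ℕ} {x : lp (fun _ : (Fin 3 → ℤ) => EuclideanSpace ℂ (Fin 3)) 2}
    (hx : x ∈ levelSubspace N) : RapidDecay (⇑x) := by
  rw [← hx.1]; exact rapidDecay_coe_cubeProj N x

end Subspace

/-! ## §2 The truncated field on the constrained level: well defined and locally Lipschitz -/

section Field

variable {ν : ℝ} {Uv : (Fin 3 → ℤ) → EuclideanSpace ℂ (Fin 3)}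

/-- The truncated field maps the constrained level to itself (part XIV's invariance + idempotence). -/
theorem cubeProj_nsField_mem (hUv : RapidDecay Uv) (hUreal : IsConjSymm Uv) {N : ℕ}
    {x : lp (fun _ : (Fin 3 → ℤ) => EuclideanSpace ℂ (Fin 3)) 2} (hx : x ∈ levelSubspace N) :
    cubeProj N (nsField ν Uv (fun j => (EuclideanSpace.proj j : EuclideanSpace ℂ (Fin 3) →L[ℂ] ℂ)) lerayCLM x) ∈
      levelSubspace N := by
  have h := cubeProj_nsField_clauses (ν := ν) hUv hUreal (rapidDecay_of_mem_levelSubspace hx) hx.2.2.1 N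
  exact ⟨lpProj_idem _ _, h.2.1, h.2.2.1, h.2.2.2⟩

/-- **The Galerkin field on the constrained level** `S_N → S_N`, `z ↦ P_N F(z)`. -/
def levelField (ν : ℝ) {Uv : (Fin 3 → ℤ) → EuclideanSpace ℂ (Fin 3)} (hUv : RapidDecay Uv)
    (hUreal : IsConjSymm Uv) (N : ℕ) (z : levelSubspace N) : levelSubspace N :=
  ⟨cubeProj N (nsField ν Uv (fun j => (EuclideanSpace.proj j : EuclideanSpace ℂ (Fin 3) →L[ℂ] ℂ)) lerayCLM z),
    cubeProj_nsField_mem hUv hUreal z.2⟩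

/-- The field, seen in `E`. -/
theorem coe_levelField (hUv : RapidDecay Uv) (hUreal : IsConjSymm Uv) {N : ℕ} (z : levelSubspace N) :
    ((levelField ν hUv hUreal N z : levelSubspace N) : lp (fun _ : (Fin 3 → ℤ) => EuclideanSpace ℂ (Fin 3)) 2) =
      cubeProj N (nsField ν Uv (fun j => (EuclideanSpace.proj j : EuclideanSpace ℂ (Fin 3) →L[ℂ] ℂ)) lerayCLM z) :=
  rfl

/-- **The inverse inequality on the cube**: for a `P_N`-fixed element, `‖⇑x‖_t² ≤ R² ‖⇑x‖_s²` with
`R = ∑_{k ∈ cube N} ⟨k⟩^{t−s} + 1`. -/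
theorem eNormSq_le_of_cubeProj_eq (s t : ℝ) {N : ℕ} {x : lp (fun _ : (Fin 3 → ℤ) => EuclideanSpace ℂ (Fin 3)) 2}
    (hx : cubeProj N x = x) :
    eNormSq t (⇑x) ≤ ENNReal.ofReal ((∑ k ∈ Fintype.piFinset (fun _ : Fin 3 => Finset.Icc (-(N : ℤ)) N),
      sobolevWeight (t - s) k + 1) ^ 2) * eNormSq s (⇑x) := by
  set Kc := Fintype.piFinset (fun _ : Fin 3 => Finset.Icc (-(N : ℤ)) N) with hKc
  have hKR : ∀ k ∈ Kc, sobolevWeight (t - s) k ≤ ∑ k ∈ Kc, sobolevWeight (t - s) k + 1 := fun k hk => by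
    have := Finset.single_le_sum (f := fun k => sobolevWeight (t - s) k)
      (fun k _ => (sobolevWeight_pos (t - s) k).le) hk
    linarith
  have hcoe : (⇑x : (Fin 3 → ℤ) → EuclideanSpace ℂ (Fin 3)) = trunc Kc ⇑x := by
    conv_lhs => rw [← hx]
    exact coe_cubeProj N x
  conv_lhs => rw [hcoe]
  exact eNormSq_trunc_le_mul_of_weight_le (weight_le_mul_of_le hKR) _


/-- `‖Λ⁻² c‖₀² = ‖c‖₋₂²`, oriented for rewriting the energy. -/
theorem eNormSq_unscale' (c : (Fin 3 → ℤ) → EuclideanSpace ℂ (Fin 3)) :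
    eNormSq 0 (wmul (-2) c) = eNormSq (-2) c := by
  rw [eNormSq_wmul]; norm_num

/-- The `E`-norm of a constrained level element is controlled by its `L²`-type energy:
`‖x‖ ≤ R_N √(‖⇑x‖₋₂²)`, `R_N = ∑_{k ∈ cube N} ⟨k⟩² + 1`. -/
theorem norm_le_of_mem_levelSubspace' {N : ℕ} {x : lp (fun _ : (Fin 3 → ℤ) => EuclideanSpace ℂ (Fin 3)) 2}
    (hx : x ∈ levelSubspace N) :
    ‖x‖ ≤ (∑ k ∈ Fintype.piFinset (fun _ : Fin 3 => Finset.Icc (-(N : ℤ)) N), sobolevWeight (0 - (-2)) k + 1) *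
      Real.sqrt (eNormSq (-2) (⇑x)).toReal := by
  set R : ℝ := ∑ k ∈ Fintype.piFinset (fun _ : Fin 3 => Finset.Icc (-(N : ℤ)) N), sobolevWeight (0 - (-2)) k + 1 with hR
  have hR0 : 0 ≤ R := add_nonneg (Finset.sum_nonneg fun k _ => (sobolevWeight_pos _ k).le) zero_le_one
  have h1 : ‖x‖ ^ 2 ≤ R ^ 2 * (eNormSq (-2) (⇑x)).toReal := by
    rw [norm_sq_eq_toReal_eNormSq_zero]
    have h := eNormSq_le_of_cubeProj_eq (-2) 0 hx.1
    have hfin : ENNReal.ofReal (R ^ 2) * eNormSq (-2) (⇑x) ≠ ∞ :=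
      ENNReal.mul_ne_top ENNReal.ofReal_ne_top ((eNormSq_mono (by norm_num) _).trans_lt (eNormSq_zero_coe_lt_top _)).ne
    have := ENNReal.toReal_mono hfin h
    rwa [ENNReal.toReal_mul, ENNReal.toReal_ofReal (sq_nonneg _)] at this
  have h2 : ‖x‖ ^ 2 ≤ (R * Real.sqrt (eNormSq (-2) (⇑x)).toReal) ^ 2 := by
    rw [mul_pow, Real.sq_sqrt ENNReal.toReal_nonneg]; exact h1
  exact (pow_le_pow_iff_left₀ (norm_nonneg _) (by positivity) two_ne_zero).1 h2

/-- **The field is Lipschitz on every ball of the constrained level.** -/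
theorem exists_lipschitzOnWith_levelField (hUv : RapidDecay Uv) (hUreal : IsConjSymm Uv) (N : ℕ) (ρ : ℝ) :
    ∃ K : ℝ≥0, LipschitzOnWith K (levelField ν hUv hUreal N) (Metric.closedBall 0 ρ) := by
  classical
  set Kc := Fintype.piFinset (fun _ : Fin 3 => Finset.Icc (-(N : ℤ)) N) with hKc
  -- finitely supported radii
  set ρ' : (Fin 3 → ℤ) → ℝ := fun k => if k ∈ Kc then max ρ 0 else 0 with hρ'
  have hρ'0 : ∀ k, 0 ≤ ρ' k := fun k => by
    simp only [hρ']; split_ifs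
    · exact le_max_right _ _
    · exact le_rfl
  have hρ'1 : Summable fun k => sobolevWeight 1 k * ρ' k := by
    refine summable_of_ne_finset_zero (s := Kc) fun k hk => ?_
    simp only [hρ', if_neg hk, mul_zero]
  have hρ'2 : Summable fun k => (sobolevWeight 2 k * ρ' k) ^ 2 := by
    refine summable_of_ne_finset_zero (s := Kc) fun k hk => ?_
    simp only [hρ', if_neg hk, mul_zero]
    norm_num
  obtain ⟨L, hL⟩ := norm_nsField_sub_sq_le (ν := ν) (P := lerayCLM)
    (π := fun j => (EuclideanSpace.proj j : EuclideanSpace ℂ (Fin 3) →L[ℂ] ℂ)) hUv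
    TransportGalerkinAbc.norm_proj_le norm_lerayCLM_le hρ'0 hρ'1 hρ'2
  -- the cube's inverse inequality constant
  set R : ℝ := ∑ k ∈ Kc, sobolevWeight (2 - 0) k + 1 with hR
  have hR0 : 0 ≤ R := add_nonneg (Finset.sum_nonneg fun k _ => (sobolevWeight_pos _ k).le) zero_le_one
  refine ⟨⟨|L| * R, by positivity⟩, fun z hz z' hz' => ?_⟩
  rw [edist_dist, edist_dist, dist_eq_norm, dist_eq_norm, ENNReal.coe_nnreal_eq,
    ← ENNReal.ofReal_mul (by positivity)]
  refine ENNReal.ofReal_le_ofReal ?_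
  -- membership of `z`, `z'` in the box `ρ'`
  have hmem : ∀ w : levelSubspace N, w ∈ Metric.closedBall (0 : levelSubspace N) ρ →
      (w : lp (fun _ : (Fin 3 → ℤ) => EuclideanSpace ℂ (Fin 3)) 2) ∈
        box ρ' (fun j => (EuclideanSpace.proj j : EuclideanSpace ℂ (Fin 3) →L[ℂ] ℂ)) lerayCLM := by
    intro w hw
    rw [Metric.mem_closedBall, dist_zero_right] at hw
    refine mem_box_of_mem_levelSubspace w.2 fun k => ?_
    simp only [hρ']
    split_ifs with hk
    · exact ((lp.norm_apply_le_norm (by norm_num) _ k).trans hw).trans (le_max_left _ _)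
    · have h0 : ((w : lp (fun _ : (Fin 3 → ℤ) => EuclideanSpace ℂ (Fin 3)) 2) : (Fin 3 → ℤ) → EuclideanSpace ℂ (Fin 3)) k = 0 := by
        have h := cubeProj_apply N (w : lp (fun _ : (Fin 3 → ℤ) => EuclideanSpace ℂ (Fin 3)) 2) k
        rw [w.2.1, if_neg hk] at h
        exact h
      rw [h0, norm_zero]
  have h1 := hL _ (hmem z hz) _ (hmem z' hz')
  -- `‖⇑z − ⇑z'‖₂² ≤ R² ‖z − z'‖²`
  have hdiff : (z : lp (fun _ : (Fin 3 → ℤ) => EuclideanSpace ℂ (Fin 3)) 2) - z' ∈ levelSubspace N :=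
    (levelSubspace N).sub_mem z.2 z'.2
  have h2 : (eNormSq 2 (⇑(z : lp (fun _ : (Fin 3 → ℤ) => EuclideanSpace ℂ (Fin 3)) 2) -
      ⇑(z' : lp (fun _ : (Fin 3 → ℤ) => EuclideanSpace ℂ (Fin 3)) 2))).toReal ≤
        R ^ 2 * ‖(z : lp (fun _ : (Fin 3 → ℤ) => EuclideanSpace ℂ (Fin 3)) 2) - z'‖ ^ 2 := by
    rw [← lp.coeFn_sub, norm_sq_eq_toReal_eNormSq_zero]
    have h := eNormSq_le_of_cubeProj_eq 0 2 hdiff.1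
    have hfin : ENNReal.ofReal (R ^ 2) * eNormSq 0 (⇑((z : lp (fun _ : (Fin 3 → ℤ) => EuclideanSpace ℂ (Fin 3)) 2) - z')) ≠ ∞ :=
      ENNReal.mul_ne_top ENNReal.ofReal_ne_top (eNormSq_zero_coe_lt_top _).ne
    have := ENNReal.toReal_mono hfin h
    rwa [ENNReal.toReal_mul, ENNReal.toReal_ofReal (sq_nonneg _)] at this
  -- assemble
  have h3 : ‖nsField ν Uv (fun j => (EuclideanSpace.proj j : EuclideanSpace ℂ (Fin 3) →L[ℂ] ℂ)) lerayCLM z -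
      nsField ν Uv (fun j => (EuclideanSpace.proj j : EuclideanSpace ℂ (Fin 3) →L[ℂ] ℂ)) lerayCLM z'‖ ≤
        |L| * R * ‖(z : lp (fun _ : (Fin 3 → ℤ) => EuclideanSpace ℂ (Fin 3)) 2) - z'‖ := by
    have hsq : ‖nsField ν Uv (fun j => (EuclideanSpace.proj j : EuclideanSpace ℂ (Fin 3) →L[ℂ] ℂ)) lerayCLM z -
        nsField ν Uv (fun j => (EuclideanSpace.proj j : EuclideanSpace ℂ (Fin 3) →L[ℂ] ℂ)) lerayCLM z'‖ ^ 2 ≤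
          (|L| * R * ‖(z : lp (fun _ : (Fin 3 → ℤ) => EuclideanSpace ℂ (Fin 3)) 2) - z'‖) ^ 2 := by
      calc _ ≤ L ^ 2 * (eNormSq 2 (⇑(z : lp (fun _ : (Fin 3 → ℤ) => EuclideanSpace ℂ (Fin 3)) 2) -
            ⇑(z' : lp (fun _ : (Fin 3 → ℤ) => EuclideanSpace ℂ (Fin 3)) 2))).toReal := h1
        _ ≤ L ^ 2 * (R ^ 2 * ‖(z : lp (fun _ : (Fin 3 → ℤ) => EuclideanSpace ℂ (Fin 3)) 2) - z'‖ ^ 2) :=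
            mul_le_mul_of_nonneg_left h2 (sq_nonneg _)
        _ = (|L| * R * ‖(z : lp (fun _ : (Fin 3 → ℤ) => EuclideanSpace ℂ (Fin 3)) 2) - z'‖) ^ 2 := by
            rw [mul_pow, mul_pow, sq_abs]; ring
    exact (pow_le_pow_iff_left₀ (norm_nonneg _) (by positivity) two_ne_zero).1 hsq
  calc ‖levelField ν hUv hUreal N z - levelField ν hUv hUreal N z'‖
      = ‖cubeProj N (nsField ν Uv (fun j => (EuclideanSpace.proj j : EuclideanSpace ℂ (Fin 3) →L[ℂ] ℂ)) lerayCLM z -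
          nsField ν Uv (fun j => (EuclideanSpace.proj j : EuclideanSpace ℂ (Fin 3) →L[ℂ] ℂ)) lerayCLM z')‖ := by
        rw [Submodule.coe_norm, Submodule.coe_sub, coe_levelField, coe_levelField, map_sub]
    _ ≤ ‖nsField ν Uv (fun j => (EuclideanSpace.proj j : EuclideanSpace ℂ (Fin 3) →L[ℂ] ℂ)) lerayCLM z -
          nsField ν Uv (fun j => (EuclideanSpace.proj j : EuclideanSpace ℂ (Fin 3) →L[ℂ] ℂ)) lerayCLM z'‖ :=
        norm_lpProj_le _ _
    _ ≤ |L| * R * ‖(z : lp (fun _ : (Fin 3 → ℤ) => EuclideanSpace ℂ (Fin 3)) 2) - z'‖ := h3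
    _ = |L| * R * ‖z - z'‖ := by rw [Submodule.coe_norm, Submodule.coe_sub]

/-- The field is continuous on the constrained level (Lipschitz on every ball). -/
theorem continuous_levelField (hUv : RapidDecay Uv) (hUreal : IsConjSymm Uv) (N : ℕ) :
    Continuous (levelField ν hUv hUreal N) := by
  refine continuous_iff_continuousAt.2 fun z => ?_
  obtain ⟨K, hK⟩ := exists_lipschitzOnWith_levelField (ν := ν) hUv hUreal N (‖z‖ + 1)
  have hball : Metric.closedBall (0 : levelSubspace N) (‖z‖ + 1) ∈ 𝓝 z := by
    refine Metric.mem_nhds_iff.2 ⟨1, one_pos, fun w hw => ?_⟩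
    rw [Metric.mem_closedBall, dist_zero_right]
    rw [Metric.mem_ball, dist_eq_norm] at hw
    calc ‖w‖ = ‖(w - z) + z‖ := by rw [sub_add_cancel]
      _ ≤ ‖w - z‖ + ‖z‖ := norm_add_le _ _
      _ ≤ ‖z‖ + 1 := by linarith
  exact (hK.continuousOn.continuousWithinAt (mem_of_mem_nhds hball)).continuousAt hball

end Field

end Summit.NavierStokesRegularity.FluidComputer.TransportGalerkinLevelSubspace

end
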